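import Literature.NumberTheory.LFunctions.GaussianThetaLValueOne
import Literature.NumberTheory.EllipticCurves.GaussianLatticeKroneckerLimit
import Literature.NumberTheory.EllipticCurves.GaussianLatticeQuarterValues
import HarnessLib

/-!
# Weight-one Hecke `L`-values of `ℚ(i)` at `s = 1` as Eisenstein–Kronecker numbers

Topic `Literature/NumberTheory/EllipticCurves` (the Gaussian-lattice cluster). We assemble

* `GaussianThetaLValueOne.tendsto_tsum_thetaLFunction_one` — for `ψ : ℤ[i] → ℂ` periodic
  modulo `M`, the value at `s = 1` of the entire continuation `thetaLFunction M ψ` of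
  `∑_x ψ(x) x N(x)^{-s}` is `lim_{y → 0⁺} ∑_x ψ(x) (x/N(x)) e^{-y N(x)}`;
* `GaussianLatticeKroneckerLimit.tendsto_tsum_exp_div_sub` — Kronecker's limit formula in
  weight one on `Λ = ℤi + ℤ`: `lim_{y → 0⁺} ∑_{l ∈ Λ} e^{-y|z-l|²}/(z-l) = ζ_Λ(z) - π z̄`;
* `GaussianLatticeQuarterValues.kroneckerE₁` — `E₁*(z) = ζ_Λ(z) - π z̄`,

into the **finite formula** (namespace `Literature.NumberTheory.EllipticCurves.GaussianLattice`)

  `thetaLFunction M ψ 1 = M⁻¹ ∑_{c mod M} ψ(c) · E₁*(conj (c/M))`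

(`thetaLFunction_one_eq_sum_kroneckerE₁`; `c` runs over the classes of `ℤ[i]/M` through their
canonical representatives `c₁ + c₂ i`, `0 ≤ c₁, c₂ < M`). Splitting the damped sum into classes,
the class of `c` is `{M(c/M - l) : l ∈ Λ}` and `x/N(x) = 1/x̄`, so its contribution is
`ψ(c) M⁻¹ conj(∑_l e^{-yM²|c/M - l|²}/(c/M - l)) → ψ(c) M⁻¹ conj E₁*(c/M) = ψ(c) M⁻¹ E₁*(conj(c/M))`
(`ζ_Λ(z̄) = conj ζ_Λ(z)` for the real lattice `Λ`, `weierstrassZeta_conj`).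

This is Rubin's Prop. 7.15 (LNM 1716: Eisenstein numbers at division points are partial Hecke
`L`-values) at `k = 1` for `K = ℚ(i)`, in the form needed for the congruent number curves
(`L(E_n, 1) = ¼ thetaLFunction (4n) ψ_n 1`, `CongruentNumberCurveRootNumber.entireLFunction_congruentNumberCurve_eq`):
the classical route of Birch–Swinnerton-Dyer (*Notes on elliptic curves II*, 1965, §3) to the
values `L(E_D, 1)`. Everything here is proved; there are no new definitions or named facts.

## References

* K. Rubin, *Elliptic curves with complex multiplication and the conjecture of Birch and
  Swinnerton-Dyer*, LNM 1716 (1999), Prop. 7.12, Prop. 7.15 (held: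
  `book:coates1999-arithmetic-theory-elliptic-curves`, pp. 244–245).
* B. J. Birch, H. P. F. Swinnerton-Dyer, *Notes on elliptic curves. II*, J. reine angew. Math.
  218 (1965) 79–108, §3.
* A. Weil, *Elliptic functions according to Eisenstein and Kronecker*, Springer 1976, VIII.
-/

noncomputable section

open UpperHalfPlane hiding I
open Complex Real Filter Topology PeriodPair
open Literature.NumberTheory.LFunctions.GaussianTheta
open scoped ComplexConjugate

namespace Literature.NumberTheory.EllipticCurves

namespace GaussianLattice

local notation "Λᵢ" => PeriodPair.ofUpperHalfPlane UpperHalfPlane.I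

/-! ### `ζ_Λ(z̄) = conj ζ_Λ(z)` for a real lattice -/

/-- `ζ_{conj Λ}(conj z) = conj ζ_Λ(z)` (reindex the absolutely convergent series along
`l ↦ conj l`; deliberate dot-notation extension of Mathlib's `PeriodPair`). [folklore] -/
theorem _root_.PeriodPair.weierstrassZeta_conjugate_conj (L : PeriodPair) (z : ℂ) :
    L.conjugate.weierstrassZeta (conj z) = conj (L.weierstrassZeta z) := by
  simp only [PeriodPair.weierstrassZeta, Complex.conj_tsum]
  rw [← L.latticeConjEquiv.tsum_eq]
  congr with l
  simp [map_sub, map_div₀, map_pow]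

/-- For a real lattice, **`ζ(conj z) = conj ζ(z)`** (deliberate dot-notation extension of
Mathlib's `PeriodPair`). [folklore] -/
theorem _root_.PeriodPair.IsReal.weierstrassZeta_conj {L : PeriodPair} (h : L.IsReal) (z : ℂ) :
    L.weierstrassZeta (conj z) = conj (L.weierstrassZeta z) := by
  rw [← PeriodPair.weierstrassZeta_conjugate_conj,
    weierstrassZeta_eq_of_lattice_eq h.conjugate_lattice_eq]

/-- **`conj E₁*(z) = E₁*(conj z)`** for the Gaussian lattice. [folklore] -/
theorem conj_kroneckerE₁ (z : ℂ) : conj (kroneckerE₁ z) = kroneckerE₁ (conj z) := by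
  rw [kroneckerE₁_def, kroneckerE₁_def, map_sub, map_mul, Complex.conj_ofReal, Complex.conj_conj,
    isReal.weierstrassZeta_conj]

/-! ### The classes of `ℤ[i]/M` inside `M⁻¹ ℤ[i]` -/

variable (M : ℕ) [NeZero M]

/-- The point `c/M ∈ ℂ` of a class `c` modulo `M` (canonical representative `c₁ + c₂ i`,
`0 ≤ c₁, c₂ < M`). [folklore] -/
def classDiv (c : ZMod M × ZMod M) : ℂ := ((rep M c 0 : GaussianInt) : ℂ) / M

omit [NeZero M] in
/-- Unfolding lemma for `classDiv`. [folklore] -/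
theorem classDiv_def (c : ZMod M × ZMod M) : classDiv M c = ((rep M c 0 : GaussianInt) : ℂ) / M :=
  rfl

/-- The bijection `ℤ × ℤ ≃ Λ`, `(m, n) ↦ -(m + n i)`, matching `rep M c (m, n) = M (c/M - l)`.
[folklore] -/
def negLatt : ℤ × ℤ ≃ (Λᵢ).lattice :=
  ((Equiv.neg (ℤ × ℤ)).trans (Equiv.prodComm ℤ ℤ)).trans (Λᵢ).latticeEquivProd.symm.toEquiv

/-- `negLatt (m, n) = -(m + n i)` as a complex number. [folklore] -/
theorem coe_negLatt (w : ℤ × ℤ) : ((negLatt w : (Λᵢ).lattice) : ℂ) = -((w.1 : ℂ) + (w.2 : ℂ) * I) := by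
  simp only [negLatt, Equiv.trans_apply, Equiv.neg_apply, Equiv.prodComm_apply, Prod.swap,
    Prod.fst_neg, Prod.snd_neg, LinearEquiv.coe_toEquiv]
  rw [show ((Λᵢ).latticeEquivProd.symm (-w.2, -w.1) : ℂ) =
    ((((Λᵢ).latticeEquivProd.symm (-w.2, -w.1)) : (Λᵢ).lattice) : ℂ) from rfl,
    coe_latticeEquivProd_symm]
  push_cast
  ring

/-- `rep M c w = M (c/M - negLatt w)` in `ℂ`. [folklore] -/
theorem toComplex_rep_eq (c : ZMod M × ZMod M) (w : ℤ × ℤ) :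
    ((rep M c w : GaussianInt) : ℂ) = M * (classDiv M c - (negLatt w : (Λᵢ).lattice)) := by
  have hM : (M : ℂ) ≠ 0 := Nat.cast_ne_zero.mpr (NeZero.ne M)
  rw [coe_negLatt, classDiv_def, rep_eq_rep_zero_add M c w, GaussianInt.toComplex_add,
    GaussianInt.toComplex_mul, GaussianInt.toComplex_def' w.1 w.2]
  simp only [map_natCast]
  field_simp
  ring

/-! ### The damped class sums -/

variable (ψ : GaussianInt → ℂ)

/-- The summand `ψ(x) (x/N(x)) e^{-y N(x)}` of the damped sum of `tendsto_tsum_thetaLFunction_one`.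
[folklore] -/
def dampedTerm (y : ℝ) (x : GaussianInt) : ℂ :=
  ψ x * (x : ℂ) / ((x.norm : ℤ) : ℂ) * ((rexp (-y * ((x.norm : ℤ) : ℝ)) : ℝ) : ℂ)

/-- `x / N(x) = conj(x)⁻¹` in `ℂ` (both sides vanish at `x = 0`). [folklore] -/
theorem div_normSq_eq_inv_conj (x : ℂ) : x / (Complex.normSq x : ℂ) = (conj x)⁻¹ := by
  rw [Complex.inv_def, Complex.conj_conj, Complex.normSq_conj, div_eq_mul_inv, Complex.ofReal_inv]

/-- **A class of the damped sum is a Gauss-damped lattice sum centred at `c/M`**: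
`ψ(rep c w) (x/N x) e^{-yN x} = ψ(c) M⁻¹ conj( e^{-yM²|c/M - l|²}/(c/M - l) )`, `x = rep c w`,
`l = negLatt w`. [folklore] -/
theorem dampedTerm_rep (hψ : ∀ x y : GaussianInt, ψ (x + M * y) = ψ x) (y : ℝ)
    (c : ZMod M × ZMod M) (w : ℤ × ℤ) :
    dampedTerm ψ y (rep M c w) = ψ (rep M c 0) * (M : ℂ)⁻¹ *
      conj ((rexp (-(M ^ 2 * y) * ‖classDiv M c - (negLatt w : (Λᵢ).lattice)‖ ^ 2) : ℂ) /
        (classDiv M c - (negLatt w : (Λᵢ).lattice))) := by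
  have hM : (M : ℂ) ≠ 0 := Nat.cast_ne_zero.mpr (NeZero.ne M)
  have hψc : ψ (rep M c w) = ψ (rep M c 0) := by rw [rep_eq_rep_zero_add M c w, hψ]
  set u : ℂ := classDiv M c - (negLatt w : (Λᵢ).lattice) with hu
  have hx : ((rep M c w : GaussianInt) : ℂ) = M * u := toComplex_rep_eq M c w
  have hN : (((rep M c w).norm : ℤ) : ℝ) = (M : ℝ) ^ 2 * ‖u‖ ^ 2 := by
    rw [GaussianInt.intCast_real_norm, hx, Complex.normSq_eq_norm_sq, norm_mul, Complex.norm_natCast]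
    ring
  have hNc : (((rep M c w).norm : ℤ) : ℂ) = (Complex.normSq ((M : ℂ) * u) : ℂ) := by
    rw [GaussianInt.intCast_complex_norm, hx]
  rw [dampedTerm, hψc, mul_div_assoc, hNc, hx, div_normSq_eq_inv_conj, hN, map_div₀,
    Complex.conj_ofReal, map_mul, map_natCast, mul_inv]
  have he : rexp (-y * ((M : ℝ) ^ 2 * ‖u‖ ^ 2)) = rexp (-((M : ℝ) ^ 2 * y) * ‖u‖ ^ 2) := by
    congr 1; ring
  rw [he]
  ring

/-- The damped sum converges absolutely for `y > 0`. [folklore] -/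
theorem summable_dampedTerm (hψ : ∀ x y : GaussianInt, ψ (x + M * y) = ψ x) {y : ℝ} (hy : 0 < y) :
    Summable (dampedTerm ψ y) := by
  set C : ℝ := ∑ c : ZMod M × ZMod M, ‖ψ (rep M c 0)‖ with hC
  refine Summable.of_norm_bounded ((summable_exp_neg_mul_norm hy).mul_left C) fun x ↦ ?_
  rw [dampedTerm, norm_mul, Complex.norm_real, Real.norm_eq_abs, abs_of_pos (Real.exp_pos _)]
  refine mul_le_mul_of_nonneg_right ?_ (Real.exp_pos _).le
  rw [norm_div, norm_mul]
  rcases eq_or_ne x 0 with rfl | hx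
  · simp only [map_zero, norm_zero, mul_zero, zero_div]
    exact Finset.sum_nonneg fun c _ ↦ norm_nonneg _
  · have hN : (0 : ℝ) < ((x.norm : ℤ) : ℝ) := by exact_mod_cast GaussianInt.norm_pos.mpr hx
    have hNc : ‖(((x.norm : ℤ) : ℂ))‖ = ((x.norm : ℤ) : ℝ) := by
      rw [← Complex.ofReal_intCast, Complex.norm_real, Real.norm_eq_abs, abs_of_pos hN]
    have hx1 : ‖(x : ℂ)‖ ≤ ((x.norm : ℤ) : ℝ) := by
      have h1 : (1 : ℝ) ≤ ((x.norm : ℤ) : ℝ) := by exact_mod_cast GaussianInt.norm_pos.mpr hx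
      have h2 : ‖(x : ℂ)‖ ^ 2 = ((x.norm : ℤ) : ℝ) := by
        rw [Complex.sq_norm, ← GaussianInt.intCast_real_norm]
      nlinarith [norm_nonneg (x : ℂ)]
    rw [hNc, div_le_iff₀ hN]
    calc ‖ψ x‖ * ‖(x : ℂ)‖ ≤ C * ((x.norm : ℤ) : ℝ) :=
          mul_le_mul (norm_le_of_periodic M ψ hψ x) hx1 (norm_nonneg _)
            (Finset.sum_nonneg fun c _ ↦ norm_nonneg _)
      _ = C * ((x.norm : ℤ) : ℝ) := rfl

/-- **Splitting the damped sum into classes**: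
`∑_x ψ(x)(x/N x)e^{-yN x} = ∑_{c mod M} ψ(c) M⁻¹ conj(∑_{l ∈ Λ} e^{-yM²|c/M-l|²}/(c/M-l))`
for `y > 0`. [folklore] -/
theorem tsum_dampedTerm_eq (hψ : ∀ x y : GaussianInt, ψ (x + M * y) = ψ x) {y : ℝ} (hy : 0 < y) :
    ∑' x, dampedTerm ψ y x = ∑ c : ZMod M × ZMod M, ψ (rep M c 0) * (M : ℂ)⁻¹ *
      conj (∑' l : (Λᵢ).lattice, (rexp (-(M ^ 2 * y) * ‖classDiv M c - (l : ℂ)‖ ^ 2) : ℂ) /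
        (classDiv M c - l)) := by
  classical
  have hs := summable_dampedTerm M ψ hψ hy
  have key : ∀ c : ZMod M × ZMod M,
      HasSum (fun x ↦ if cls M x = c then dampedTerm ψ y x else 0)
        (ψ (rep M c 0) * (M : ℂ)⁻¹ * conj (∑' l : (Λᵢ).lattice,
          (rexp (-(M ^ 2 * y) * ‖classDiv M c - (l : ℂ)‖ ^ 2) : ℂ) / (classDiv M c - l))) := by
    intro c
    set G : (Λᵢ).lattice → ℂ := fun l ↦
      (rexp (-(M ^ 2 * y) * ‖classDiv M c - (l : ℂ)‖ ^ 2) : ℂ) / (classDiv M c - l) with hG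
    have hoff : ∀ x ∉ Set.range (rep M c),
        (fun x ↦ if cls M x = c then dampedTerm ψ y x else 0) x = 0 := by
      intro x hx
      rw [range_rep] at hx
      exact if_neg hx
    refine ((rep_injective M c).hasSum_iff hoff).mp ?_
    have heq : ((fun x ↦ if cls M x = c then dampedTerm ψ y x else 0) ∘ rep M c) =
        fun w ↦ ψ (rep M c 0) * (M : ℂ)⁻¹ * conj (G (negLatt w)) := by
      funext w
      simp only [Function.comp_apply, cls_rep, if_true]
      exact dampedTerm_rep M ψ hψ y c w
    rw [heq]
    by_cases hψ0 : ψ (rep M c 0) = 0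
    · simp only [hψ0, zero_mul]
      exact hasSum_zero
    · -- summability of the class sum, read off from that of the damped sum
      have h1 : Summable ((fun x ↦ dampedTerm ψ y x) ∘ rep M c) := hs.comp_injective (rep_injective M c)
      have heq1 : ((fun x ↦ dampedTerm ψ y x) ∘ rep M c) =
          fun w ↦ ψ (rep M c 0) * (M : ℂ)⁻¹ * conj (G (negLatt w)) := by
        funext w
        exact dampedTerm_rep M ψ hψ y c w
      rw [heq1] at h1
      have hne : ψ (rep M c 0) * (M : ℂ)⁻¹ ≠ 0 :=
        mul_ne_zero hψ0 (inv_ne_zero (Nat.cast_ne_zero.mpr (NeZero.ne M)))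
      have h2 : Summable fun w ↦ conj (G (negLatt w)) := by
        have := h1.mul_left (ψ (rep M c 0) * (M : ℂ)⁻¹)⁻¹
        simp only [← mul_assoc, inv_mul_cancel₀ hne, one_mul] at this
        exact this
      have h3 : Summable (G ∘ negLatt) := Complex.summable_conj.mp h2
      have h4 : Summable G := (negLatt.summable_iff).mp h3
      have h5 : HasSum (G ∘ negLatt) (∑' l, G l) := (negLatt.hasSum_iff).mpr h4.hasSum
      exact (Complex.hasSum_conj'.mpr h5).mul_left (ψ (rep M c 0) * (M : ℂ)⁻¹)
  have := hasSum_sum (s := (Finset.univ : Finset (ZMod M × ZMod M))) fun c _ ↦ key c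
  have h5 : HasSum (dampedTerm ψ y) (∑ c : ZMod M × ZMod M, ψ (rep M c 0) * (M : ℂ)⁻¹ *
      conj (∑' l : (Λᵢ).lattice, (rexp (-(M ^ 2 * y) * ‖classDiv M c - (l : ℂ)‖ ^ 2) : ℂ) /
        (classDiv M c - l))) := by
    refine this.congr_fun fun x ↦ ?_
    simp only [Finset.sum_ite_eq, Finset.mem_univ, if_true]
  exact h5.tsum_eq

/-! ### The finite formula -/

/-- **Hecke `L`-values of `ℚ(i)` of weight one at `s = 1` as Eisenstein–Kronecker numbers**
(Rubin, LNM 1716, Prop. 7.15 at `k = 1`; Birch–Swinnerton-Dyer 1965, §3): for `ψ : ℤ[i] → ℂ`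
periodic modulo `M ≥ 1`,
`thetaLFunction M ψ 1 = M⁻¹ ∑_{c mod M} ψ(c) E₁*(conj(c/M))`, `E₁*(z) = ζ_{ℤi+ℤ}(z) - π z̄`.
[cite: Rubin1999, Prop. 7.15] -/
theorem thetaLFunction_one_eq_sum_kroneckerE₁ (hψ : ∀ x y : GaussianInt, ψ (x + M * y) = ψ x) :
    thetaLFunction M ψ 1 =
      (M : ℂ)⁻¹ * ∑ c : ZMod M × ZMod M, ψ (rep M c 0) * kroneckerE₁ (conj (classDiv M c)) := by
  have hM : (0 : ℝ) < M := by exact_mod_cast Nat.pos_of_ne_zero (NeZero.ne M)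
  -- the damped sums tend to the `L`-value …
  have hL := tendsto_tsum_thetaLFunction_one M ψ hψ
  -- … and, class by class, to the Eisenstein–Kronecker numbers
  have hE : Tendsto (fun y : ℝ ↦ ∑' x, dampedTerm ψ y x) (𝓝[>] 0)
      (𝓝 (∑ c : ZMod M × ZMod M, ψ (rep M c 0) * (M : ℂ)⁻¹ * conj (kroneckerE₁ (classDiv M c)))) := by
    have hc : ∀ c : ZMod M × ZMod M, Tendsto (fun y : ℝ ↦ ψ (rep M c 0) * (M : ℂ)⁻¹ *
        conj (∑' l : (Λᵢ).lattice, (rexp (-(M ^ 2 * y) * ‖classDiv M c - (l : ℂ)‖ ^ 2) : ℂ) /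
          (classDiv M c - l))) (𝓝[>] 0)
        (𝓝 (ψ (rep M c 0) * (M : ℂ)⁻¹ * conj (kroneckerE₁ (classDiv M c)))) := by
      intro c
      have h1 := (tendsto_tsum_exp_div_sub (classDiv M c)).comp
        (tendsto_const_mul_nhdsGT_zero (c := (M : ℝ) ^ 2) (by positivity))
      rw [← kroneckerE₁_def] at h1
      exact ((Complex.continuous_conj.tendsto _).comp h1).const_mul _
    refine (tendsto_finsetSum _ fun c _ ↦ hc c).congr' ?_
    filter_upwards [self_mem_nhdsWithin] with y (hy : 0 < y)
    exact (tsum_dampedTerm_eq M ψ hψ hy).symm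
  have heq := tendsto_nhds_unique hL hE
  rw [heq, Finset.mul_sum]
  refine Finset.sum_congr rfl fun c _ ↦ ?_
  rw [conj_kroneckerE₁]
  ring

end GaussianLattice

end Literature.NumberTheory.EllipticCurves
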